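import Summits.AtomisticToContinuum.HydrodynamicLimit.Theorems.RelayRaceLocalityConeLocalisationElevatorConjDefs
import Summits.AtomisticToContinuum.HydrodynamicLimit.Theorems.RelayRaceLocalityConeLocalisationStubLogCurvature
import Summits.AtomisticToContinuum.HydrodynamicLimit.Theorems.RelayRaceLocalityConeLocalisationStubStraightness
import HarnessLib

/-!
# RelayRaceLocality · ConeLocalisation — line `einstein-elevator`, stub `stub_transfer_conj` and the line's certificate

Support file for the crux item `stmt-AtomisticToContinuum-12504` (`ConeLocalisation`, route RelayRaceLocality of
`AtomisticToContinuum/HydrodynamicLimit`), line lead a1 (prover-line-stmt-AtomisticToContinuum-12504-a1-0, 2026-08-17),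
skeleton v2 of the line `einstein-elevator` (`Cruxes/ConeLocalisation/Lines/EinsteinElevatorSketch.lean`):

* `stub_transfer_conj : ElevatorOrbitHLConj → DynamicNearAtmosphere → ShortTimeGuardedHL` (registered stub) — the transfer of
  skeleton v1 (`stub_transfer`, p144518) re-run from the RESHAPED foreign stub (the conjunct-family restriction
  `ElevatorOrbitHLConj`, `…ElevatorConjDefs.lean`): same bookkeeping (`η₀ := min`, `Θ := C Mᵃ + 1`, `τ₁ := min τ (C Mᵃ/(4K))`,
  scale `ℓ₀ := t/(C Mᵃ)`, `GuardAt ⇒ GuardAtScale ℓ₀`), minus the family instantiation and the probability clause;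
* `dynamicNearAtmosphere_holds : DynamicNearAtmosphere` — the PDE side of the line is now UNCONDITIONAL: the three landed stubs
  `stub_logSlope` (p147742), `stub_logCurvature` (p152481), `stub_straightness` (p153189) compose;
* `shortTimeGuardedHL_of_elevatorOrbitHLConj : ElevatorOrbitHLConj → ShortTimeGuardedHL` and
  `coneLocalisation_of_elevatorOrbitHLConj : ElevatorOrbitHLConj → ConeLocalisation` — THE LINE'S CERTIFICATE: the crux AS TYPED
  (unfloored `S`) follows from the single foreign near-equilibrium input, a necessary condition of the summit
  (`elevatorOrbitHLConj_of_hydrodynamicLimit`), the two antecedents of the crux being unused;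
* `shortTimeGuardedHL_of_hydrodynamicLimit'` — sanity: the sandwich `G ⟹ EOHL♮ ⟹ S` closes (of course `G → S` directly too).
-/

noncomputable section

namespace Summit.AtomisticToContinuum.HydrodynamicLimit.Theorems.ConeLocalisation.Elevator

open scoped Topology
open Filter Set MeasureTheory
open Literature.MathematicalPhysics.KineticTheory Literature.Analysis.FluidPDE
  Literature.Analysis.FunctionSpaces
open Summit.AtomisticToContinuum.HydrodynamicLimit.Theses.RelayRaceLocality

/-- **STUB `stub_transfer_conj` of the line `einstein-elevator` (skeleton v2, registered on stmt-AtomisticToContinuum-12504):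
the conjunct-family foreign input around the elevator orbit and the dynamic near-atmosphere property of the guard class give
the UNFLOORED short-time guarded hydrodynamic limit `S`.** [folklore] -/
theorem stub_transfer_conj : ElevatorOrbitHLConj → DynamicNearAtmosphere → ShortTimeGuardedHL := by
  rintro ⟨η₀E, hη₀E, HE⟩ ⟨η₁, hη₁, C, hC, a, HN⟩
  refine ⟨min η₀E η₁, lt_min hη₀E hη₁, fun M hM => ?_⟩
  by_cases hM1 : M < 1
  · -- the level-`M` guards are unsatisfiable: any horizon works
    refine ⟨1, one_pos, fun a₀ θ₀ u₀ _ _ _ _ _ => ⟨1, one_pos, ?_⟩⟩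
    intro σ _ _ T ρ θ u _ Φ _ t ht hg
    exact absurd (hg 0 ⟨le_rfl, ht.1⟩ (0 : T3)) (not_guardAt_of_lt_one hM hM1)
  rw [not_lt] at hM1
  -- `M ≥ 1`: the natural horizon `Θ := C Mᵃ + 1`, then `K, δ`, then `τ`
  have hCMa : 0 < C * M ^ a := by positivity
  set Θ : ℝ := C * M ^ a + 1 with hΘdef
  have hΘ : 0 < Θ := by positivity
  obtain ⟨K, hK, δ, hδ, HE1⟩ := HE M hM Θ hΘ
  have hK0 : 0 < K := by linarith
  obtain ⟨τ, hτ, HN1⟩ := HN M hM1 K hK δ hδ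
  refine ⟨min τ (C * M ^ a / (4 * K)), lt_min hτ (by positivity),
    fun a₀ θ₀ u₀ ha hθ hu ha0 hθ0 => ?_⟩
  obtain ⟨σ₀E, hσ₀E, HE2⟩ := HE1 a₀ θ₀ u₀ ha hθ hu ha0 hθ0
  refine ⟨min σ₀E 1, lt_min hσ₀E one_pos, fun σ hσ hσlt T ρ θ u hEul Φ h0 t ht hg => ?_⟩
  have hσE : σ < σ₀E := lt_of_lt_of_le hσlt (min_le_left _ _)
  have hσ1 : σ ≤ 1 := (lt_of_lt_of_le hσlt (min_le_right _ _)).le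
  -- `t = 0` is the hypothesis itself
  rcases eq_or_lt_of_le ht.1 with h0t | htpos
  · rw [← h0t]; exact h0
  have htT : t < T := lt_of_lt_of_le ht.2 (min_le_left _ _)
  have htτ : t ≤ τ := (lt_of_lt_of_le ht.2 ((min_le_right _ _).trans (min_le_left _ _))).le
  have ht4K : t ≤ C * M ^ a / (4 * K) :=
    (lt_of_lt_of_le ht.2 ((min_le_right _ _).trans (min_le_right _ _))).le
  -- the scale `ℓ₀ := t / (C Mᵃ)`
  set ℓ₀ : ℝ := t / (C * M ^ a) with hℓ₀def
  have hℓ₀ : 0 < ℓ₀ := div_pos htpos hCMa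
  have hKℓ₀ : K * ℓ₀ ≤ 1 / 4 := by
    rw [hℓ₀def, mul_div_assoc', div_le_iff₀ hCMa]
    rw [le_div_iff₀ (by positivity)] at ht4K
    linarith
  have hℓ₀1 : ℓ₀ ≤ 1 := by
    have : ℓ₀ ≤ K * ℓ₀ := le_mul_of_one_le_left hℓ₀.le hK
    linarith
  have htΘ : t < Θ * ℓ₀ := by
    have h1 : Θ * ℓ₀ = t + ℓ₀ := by
      rw [hΘdef, hℓ₀def]; field_simp
    rw [h1]; linarith
  -- the guards in the two packing bands
  have hgA : ∀ s ∈ Set.Icc 0 t, ∀ x, GuardAt η₁ M σ ρ θ u s x := by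
    intro s hs x
    obtain ⟨g1, g2⟩ := hg s hs x
    exact ⟨lt_of_lt_of_le g1 (min_le_right _ _), g2⟩
  have hgS : ∀ s ∈ Set.Icc 0 t, ∀ x, GuardAtScale η₀E M ℓ₀ σ ρ θ u s x := by
    intro s hs x
    obtain ⟨g1, g2⟩ := hg s hs x
    exact guardAtScale_of_guardAt hM.le hℓ₀ hℓ₀1 ⟨lt_of_lt_of_le g1 (min_le_left _ _), g2⟩
  -- steep ⇒ straight: the near-atmosphere hypothesis at scale `ℓ₀`
  have hnear : ∀ x₀ : T3, ∃ g : V3, ‖g‖ * ℓ₀ ≤ 1 ∧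
      NearAtmosphereOn (ρ 0) (θ 0) (u 0) x₀ g (K * ℓ₀) δ :=
    HN1 σ T ρ θ u hσ hσ1 hEul t htpos htT htτ hgA
  -- the (restricted) foreign input
  exact HE2 σ hσ hσE T ρ θ u hEul ℓ₀ hℓ₀ hKℓ₀ hnear Φ h0 t ⟨ht.1, lt_min htT htΘ⟩ hgS

/-- **The PDE side of the line is unconditional**: the dynamic near-atmosphere property of the guard class of `S`
(orders 1 and 2 of the dynamic log-Lipschitz rigidity + Taylor at the cone scale; stubs `stub_logSlope` p147742,
`stub_logCurvature` p152481, `stub_straightness` p153189). [folklore] -/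
theorem dynamicNearAtmosphere_holds : DynamicNearAtmosphere :=
  stub_straightness stub_logSlope (stub_logCurvature stub_logSlope)

/-- **THE LINE'S CERTIFICATE (consequent form)**: the unfloored short-time guarded hydrodynamic limit `S` follows from the
conjunct-family near-equilibrium input around the elevator orbit alone. [folklore] -/
theorem shortTimeGuardedHL_of_elevatorOrbitHLConj (h : ElevatorOrbitHLConj) : ShortTimeGuardedHL :=
  stub_transfer_conj h dynamicNearAtmosphere_holds

/-- **THE LINE'S CERTIFICATE (crux form)**: the crux `ConeLocalisation` AS TYPED follows from `ElevatorOrbitHLConj` alone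
(its two antecedents `LightConeInLaw`, `NearConstantShortTimeHL` unused). [folklore] -/
theorem coneLocalisation_of_elevatorOrbitHLConj (h : ElevatorOrbitHLConj) : ConeLocalisation :=
  fun _ _ => shortTimeGuardedHL_of_elevatorOrbitHLConj h

/-- The same from the full (general-family) foreign stub of skeleton v1. [folklore] -/
theorem coneLocalisation_of_elevatorOrbitHL (h : ElevatorOrbitHL) : ConeLocalisation :=
  coneLocalisation_of_elevatorOrbitHLConj (elevatorOrbitHLConj_of_elevatorOrbitHL h)

/-- Sanity (the sandwich closes): `G → S` through `EOHL♮` (directly: `RestartPrincipleNegative.guardedConjunct_imp_shortTimeGuardedHL`).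
[folklore] -/
theorem shortTimeGuardedHL_of_hydrodynamicLimit' (hG : _root_.HydrodynamicLimit) : ShortTimeGuardedHL :=
  shortTimeGuardedHL_of_elevatorOrbitHLConj (elevatorOrbitHLConj_of_hydrodynamicLimit hG)

end Summit.AtomisticToContinuum.HydrodynamicLimit.Theorems.ConeLocalisation.Elevator

end
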